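import Summits.QuantumFields.BalabanUV.T4Continuum.Support.NE7EJFlatSecular

/-!
# NE7EJSecularCriterion — row NE7 (node U5), candidate route HOM, variant H1L-EJ, item EJ-1b′ (T1)–(T3′): LENS 1's SECULAR CRITERION
# (P-EJ-9 NOTE §1 (A3) = ADDENDUM Lemma D-a) IN KERNEL, AND THE FLAT SHARP MASTER INEQUALITY AT THE ALIAS-BLOCK (OPERATOR) LEVEL FOR
# EVERY FINE MOMENTUM — `|t⟩⟨t| ≤ diag g(ω_n)` on each 4-dimensional alias block, all tori at once, equality exactly on the axes

Lineage `b2b-balaban-t4-ne7-p2` (CRUX PROVER NE7 #2 = C-HOM°'s kernel hand), generation 81; file 118 (sequel of 117 `NE7EJFlatSecular`).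

SOURCE (lens 1, `t4/ideate/NE7/lens1-g67/DEFECT-VS-HESSIAN-NOTE.md` 9e7cf2b6f8adbc99 §1): (A2) transports «EF^flat ≥ φ(Hess^flat) on phys» to
«4A†A ≤ g(−Δ_plaq) on mean-zero plaquette fields, g := 1 − φ(x)∕x»; (A3): «A couples p only to its aliases p + πn, n ∈ {0,1}²; in each alias
block 4A†A = |t⟩⟨t| is RANK ONE with |t_n|² = Π_μ w_μ(n_μ), w_μ(0) = cos⁴(p_μ∕2), w_μ(1) = sin⁴(p_μ∕2) …  For g > 0 on the block,
|t⟩⟨t| ≤ diag g(ω_n) ⇔ S_φ(p) := Σ_n |t_n|²∕g(ω_n) ≤ 1, ω_n = 4Σ_μ (n_μ ? cos² : sin²)(p_μ∕2).  So the flat master inequality for φ is ONE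
inequality between explicit trigonometric polynomials in two variables, all M at once (infinite volume included).»  THIS FILE:
* §1 **`rankOne_le_diag_iff`** — the criterion itself, for any finite index type: `(∀ v, (Σ t_i v_i)² ≤ Σ g_i v_i²) ↔ Σ t_i²∕g_i ≤ 1`
  (`g > 0`; Cauchy–Schwarz one way, the test vector `v = t∕g` the other); `rankOne_le_diag_mul` (the quantitative form
  `(Σ t v)² ≤ S·Σ g v²`); the COMPLEX (Hermitian) version **`rankOne_le_diag_iff_complex`** `(∀ v, ‖Σ conj(t_i) v_i‖² ≤ Σ g_i ‖v_i‖²) ↔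
  Σ ‖t_i‖²∕g_i ≤ 1` — phases of `t` are immaterial against a diagonal.
* §2 the alias block at momentum `p = (p₁,p₂)`: `omegaA p n = 4Σ_μ sin²((p_μ + πn_μ)∕2)` (the plaquette-Laplacian symbol at the alias
  momentum), `tSq p n = Π_μ (n_μ ? sin⁴ : cos⁴)(p_μ∕2)` (`|t_n|²`), `gFlat ω = 1 − (½ω − ⅛ω²)` (`g = 1 − φ(ω)∕ω` for `φ = ⅛x²(4−x)`), and
  the dictionary to file 117: `omegaA = 4·uu`, `tSq = ww`, `gFlat ∘ omegaA = G ∘ uu` at `y_μ = sin²(p_μ∕2)`; `gFlat_pos`.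
* §3 **`flat_block_ineq`**: for EVERY `p ∈ ℝ²` and every real `v` on the block, `(Σ_n |t_n| v_n)² ≤ Σ_n g(ω_n) v_n²`; the complex form
  **`flat_block_ineq_complex`** for any amplitudes `t_n ∈ ℂ` with `‖t_n‖² = tSq p n`; **`flat_block_sharp`** (on an axis, `sin p₂ = 0` or
  `sin p₁ = 0`, equality is ATTAINED by a non-zero vector) and **`flat_block_strict`** (off the axes the inequality is strict on `v ≠ 0`).
The transport (A2) from these block inequalities to `EF^flat ≥ φ(Hess^flat)` is file 119 (abstract) — the lattice Fourier bookkeeping that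
identifies lens 1's tent average `A` and plaquette Laplacian with these symbols is hers [paper] and is NOT typed here.

HONEST FRAMING: [folklore] (Cauchy–Schwarz + file 117's polynomial certificate); lens 1's toy objects stay hers; nothing of Bałaban's
instantiated; d = 2 flat toy level, NOT the curved (MI₂), NOT d = 4, NOT a letter move (PRICING-NE7 v50); T-50-10 honoured.  NE7 NOT PRINTED ∕
NOT PROVED; spine 0∕9; FIXED FINITE T⁴, rung (B)+1; NOT infinite volume, NOT mass gap, NOT Clay.  HONEST DEPENDENCY: continuum YM on T⁴ ⇐
BetaPertH ∧ nine spine estimates (0/9 proved); BetaPertH ⇐ (D1) ∧ (D4) ∧ CAP+tail; G-an2-4 gates asym, D1 and NE2/3/4.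
-/

noncomputable section

open Finset Real

namespace Summit.QuantumFields.BalabanUV.T4Continuum.NE7EJSecularCriterion

open NE7EJFlatSecular

/-! ### §1 The rank-one-vs-diagonal criterion -/

section Criterion

variable {ι : Type*} [Fintype ι]

/-- Cauchy–Schwarz in the weighted form: `(Σ t_i v_i)² ≤ (Σ t_i²∕g_i)·(Σ g_i v_i²)` for `g > 0`. [folklore] -/
theorem rankOne_le_diag_mul {g : ι → ℝ} (hg : ∀ i, 0 < g i) (t v : ι → ℝ) :
    (∑ i, t i * v i) ^ 2 ≤ (∑ i, t i ^ 2 / g i) * ∑ i, g i * v i ^ 2 := by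
  have h := sum_mul_sq_le_sq_mul_sq univ (fun i => t i / Real.sqrt (g i)) (fun i => Real.sqrt (g i) * v i)
  have e1 : ∀ i, t i / Real.sqrt (g i) * (Real.sqrt (g i) * v i) = t i * v i := fun i => by
    have hs : Real.sqrt (g i) ≠ 0 := (Real.sqrt_pos.mpr (hg i)).ne'
    field_simp
  have e2 : ∀ i, (t i / Real.sqrt (g i)) ^ 2 = t i ^ 2 / g i := fun i => by
    rw [div_pow, Real.sq_sqrt (hg i).le]
  have e3 : ∀ i, (Real.sqrt (g i) * v i) ^ 2 = g i * v i ^ 2 := fun i => by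
    rw [mul_pow, Real.sq_sqrt (hg i).le]
  simp only [e1, e2, e3] at h
  exact h

/-- **THE SECULAR CRITERION** (lens 1 (A3) ∕ ADDENDUM Lemma D-a): for `g > 0` on a finite index set, the rank-one form is dominated by
the diagonal one, `(Σ_i t_i v_i)² ≤ Σ_i g_i v_i²` for every `v`, IF AND ONLY IF `Σ_i t_i²∕g_i ≤ 1`. [folklore] -/
theorem rankOne_le_diag_iff {g : ι → ℝ} (hg : ∀ i, 0 < g i) (t : ι → ℝ) :
    (∀ v : ι → ℝ, (∑ i, t i * v i) ^ 2 ≤ ∑ i, g i * v i ^ 2) ↔ ∑ i, t i ^ 2 / g i ≤ 1 := by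
  constructor
  · intro h
    -- test vector `v = t ∕ g`
    have hv := h fun i => t i / g i
    have e1 : ∑ i, t i * (t i / g i) = ∑ i, t i ^ 2 / g i := sum_congr rfl fun i _ => by ring
    have e2 : ∑ i, g i * (t i / g i) ^ 2 = ∑ i, t i ^ 2 / g i := sum_congr rfl fun i _ => by
      field_simp [(hg i).ne']
    rw [e1, e2] at hv
    have hS : 0 ≤ ∑ i, t i ^ 2 / g i := sum_nonneg fun i _ => div_nonneg (sq_nonneg _) (hg i).le
    nlinarith
  · intro hS v
    have hW : 0 ≤ ∑ i, g i * v i ^ 2 := sum_nonneg fun i _ => mul_nonneg (hg i).le (sq_nonneg _)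
    calc (∑ i, t i * v i) ^ 2 ≤ (∑ i, t i ^ 2 / g i) * ∑ i, g i * v i ^ 2 := rankOne_le_diag_mul hg t v
      _ ≤ 1 * ∑ i, g i * v i ^ 2 := by gcongr
      _ = ∑ i, g i * v i ^ 2 := one_mul _

/-- the equality witness: at `v = t∕g` both sides equal `S` resp. `S²` — so when `S = 1` the bound is ATTAINED. [folklore] -/
theorem rankOne_test_vector {g : ι → ℝ} (hg : ∀ i, 0 < g i) (t : ι → ℝ) :
    (∑ i, t i * (t i / g i)) ^ 2 = (∑ i, t i ^ 2 / g i) ^ 2 ∧ ∑ i, g i * (t i / g i) ^ 2 = ∑ i, t i ^ 2 / g i := by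
  refine ⟨by rw [sum_congr rfl fun i _ => show t i * (t i / g i) = t i ^ 2 / g i by ring], sum_congr rfl fun i _ => ?_⟩
  field_simp [(hg i).ne']

/-- triangle step for the complex version: `‖Σ conj(t_i) v_i‖ ≤ Σ ‖t_i‖‖v_i‖`. [folklore] -/
theorem norm_sum_conj_mul_le (t v : ι → ℂ) : ‖∑ i, starRingEnd ℂ (t i) * v i‖ ≤ ∑ i, ‖t i‖ * ‖v i‖ := by
  refine (norm_sum_le _ _).trans (le_of_eq (sum_congr rfl fun i _ => ?_))
  rw [norm_mul, Complex.norm_conj]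

/-- **THE SECULAR CRITERION, HERMITIAN FORM**: for complex amplitudes `t` and `g > 0`, `‖Σ conj(t_i) v_i‖² ≤ Σ g_i ‖v_i‖²` for every
complex `v` IFF `Σ ‖t_i‖²∕g_i ≤ 1` — the phases of `t` are immaterial against a diagonal form. [folklore] -/
theorem rankOne_le_diag_iff_complex {g : ι → ℝ} (hg : ∀ i, 0 < g i) (t : ι → ℂ) :
    (∀ v : ι → ℂ, ‖∑ i, starRingEnd ℂ (t i) * v i‖ ^ 2 ≤ ∑ i, g i * ‖v i‖ ^ 2) ↔ ∑ i, ‖t i‖ ^ 2 / g i ≤ 1 := by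
  constructor
  · intro h
    have hv := h fun i => t i / (g i : ℂ)
    have e1 : ∑ i, starRingEnd ℂ (t i) * (t i / (g i : ℂ)) = ((∑ i, ‖t i‖ ^ 2 / g i : ℝ) : ℂ) := by
      push_cast
      refine sum_congr rfl fun i _ => ?_
      rw [← mul_div_assoc, Complex.conj_mul']
    have e2 : ∑ i, g i * ‖t i / (g i : ℂ)‖ ^ 2 = ∑ i, ‖t i‖ ^ 2 / g i := sum_congr rfl fun i _ => by
      rw [norm_div, Complex.norm_real, Real.norm_of_nonneg (hg i).le]
      field_simp [(hg i).ne']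
    rw [e1, e2, Complex.norm_real, Real.norm_eq_abs, sq_abs] at hv
    have hS : 0 ≤ ∑ i, ‖t i‖ ^ 2 / g i := sum_nonneg fun i _ => div_nonneg (sq_nonneg _) (hg i).le
    nlinarith
  · intro hS v
    have h1 := norm_sum_conj_mul_le t v
    have h0 : 0 ≤ ‖∑ i, starRingEnd ℂ (t i) * v i‖ := norm_nonneg _
    have h2 : (∑ i, ‖t i‖ * ‖v i‖) ^ 2 ≤ ∑ i, g i * ‖v i‖ ^ 2 :=
      (rankOne_le_diag_iff hg (fun i => ‖t i‖)).mpr hS fun i => ‖v i‖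
    calc ‖∑ i, starRingEnd ℂ (t i) * v i‖ ^ 2 ≤ (∑ i, ‖t i‖ * ‖v i‖) ^ 2 := by gcongr
      _ ≤ ∑ i, g i * ‖v i‖ ^ 2 := h2

end Criterion

/-! ### §2 The alias block at a fine momentum `p = (p₁, p₂)` (d = 2, L = 2) -/

/-- the plaquette-Laplacian symbol `ω(q) = 4Σ_μ sin²(q_μ∕2)` at the ALIAS momentum `q = p + πn`. [folklore] -/
def omegaA (p₁ p₂ : ℝ) (n : Alias) : ℝ :=
  4 * sin ((p₁ + if n.1 then π else 0) / 2) ^ 2 + 4 * sin ((p₂ + if n.2 then π else 0) / 2) ^ 2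

/-- the squared alias amplitude `|t_n|² = Π_μ (cos⁴(p_μ∕2) if n_μ = 0 else sin⁴(p_μ∕2))` of lens 1's tent average (her (A3)). [folklore] -/
def tSq (p₁ p₂ : ℝ) (n : Alias) : ℝ :=
  (if n.1 then sin (p₁ / 2) ^ 4 else cos (p₁ / 2) ^ 4) * (if n.2 then sin (p₂ / 2) ^ 4 else cos (p₂ / 2) ^ 4)

/-- `g(ω) := 1 − φ(ω)∕ω = 1 − (½ω − ⅛ω²)` for the flat-sharp cubic `φ = ⅛x²(4 − x)`. [folklore] -/
def gFlat (ω : ℝ) : ℝ := 1 - ((1 / 2) * ω - (1 / 8) * ω ^ 2)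

/-- `g(ω) = G(ω∕4)` (file 117's denominator). [folklore] -/
theorem gFlat_eq_G (ω : ℝ) : gFlat ω = G (ω / 4) := by
  rw [G_eq_one_sub_psi]; unfold gFlat; ring

/-- `0 < g(ω)` for every real `ω` (indeed `g ≥ ½`): the criterion's positivity hypothesis holds on every block. [folklore] -/
theorem gFlat_pos (ω : ℝ) : 0 < gFlat ω := by rw [gFlat_eq_G]; exact G_pos _

/-- `g(ω)·ω = ω − φ(ω)` with `φ(ω) = ½ω² − ⅛ω³ = ⅛ω²(4 − ω)`: the dictionary back to the cubic. [folklore] -/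
theorem gFlat_mul (ω : ℝ) : gFlat ω * ω = ω - (1 / 8) * ω ^ 2 * (4 - ω) := by unfold gFlat; ring

/-- dictionary: `ω_n(p) = 4·u_n(y)` at `y_μ = sin²(p_μ∕2)` (the alias shift `p ↦ p + π` turns `sin²` into `cos² = 1 − sin²`). [folklore] -/
theorem omegaA_eq_four_uu (p₁ p₂ : ℝ) (n : Alias) : omegaA p₁ p₂ n = 4 * uu (sin (p₁ / 2) ^ 2) (sin (p₂ / 2) ^ 2) n := by
  obtain ⟨n₁, n₂⟩ := n
  unfold omegaA uu
  cases n₁ <;> cases n₂ <;> simp [sin_sq_half_add_pi] <;> ring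

/-- dictionary: `|t_n|²(p) = w_n(y)` at `y_μ = sin²(p_μ∕2)` (`cos⁴ = (1 − sin²)²`). [folklore] -/
theorem tSq_eq_ww (p₁ p₂ : ℝ) (n : Alias) : tSq p₁ p₂ n = ww (sin (p₁ / 2) ^ 2) (sin (p₂ / 2) ^ 2) n := by
  obtain ⟨n₁, n₂⟩ := n
  have c1 : cos (p₁ / 2) ^ 4 = (1 - sin (p₁ / 2) ^ 2) ^ 2 := by rw [one_sub_sin_sq_half]; ring
  have c2 : cos (p₂ / 2) ^ 4 = (1 - sin (p₂ / 2) ^ 2) ^ 2 := by rw [one_sub_sin_sq_half]; ring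
  cases n₁ <;> cases n₂ <;> simp only [tSq, ww, Bool.false_eq_true, ↓reduceIte, c1, c2] <;> ring

/-- dictionary: `g(ω_n(p)) = G(u_n(y))`. [folklore] -/
theorem gFlat_omegaA (p₁ p₂ : ℝ) (n : Alias) : gFlat (omegaA p₁ p₂ n) = G (uu (sin (p₁ / 2) ^ 2) (sin (p₂ / 2) ^ 2) n) := by
  rw [gFlat_eq_G, omegaA_eq_four_uu]; ring_nf

/-- `0 ≤ |t_n|²`. [folklore] -/
theorem tSq_nonneg (p₁ p₂ : ℝ) (n : Alias) : 0 ≤ tSq p₁ p₂ n := by rw [tSq_eq_ww]; exact ww_nonneg _ _ _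

/-- the block's secular sum IS file 117's `S_φ` at `y = sin²(p∕2)`: `Σ_n |t_n|²∕g(ω_n) = secularS y₁ y₂`. [folklore] -/
theorem block_secular_eq (p₁ p₂ : ℝ) :
    ∑ n, tSq p₁ p₂ n / gFlat (omegaA p₁ p₂ n) = secularS (sin (p₁ / 2) ^ 2) (sin (p₂ / 2) ^ 2) := by
  unfold secularS
  exact sum_congr rfl fun n _ => by rw [tSq_eq_ww, gFlat_omegaA]

/-- with the non-negative amplitude `|t_n| = √(|t_n|²)`: `|t_n|² ∕ g = tSq ∕ g`. [folklore] -/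
theorem sqrt_tSq_sq (p₁ p₂ : ℝ) (n : Alias) : Real.sqrt (tSq p₁ p₂ n) ^ 2 = tSq p₁ p₂ n := Real.sq_sqrt (tSq_nonneg _ _ _)

/-! ### §3 The flat sharp master inequality at the alias-block level, every momentum -/

/-- **THE FLAT SHARP MASTER INEQUALITY, BLOCK FORM** (lens 1 (A3) + THEOREM (hh)): for EVERY fine momentum `p = (p₁,p₂) ∈ ℝ²` and every
real vector `v` on the alias block `{0,1}²`, `(Σ_n |t_n(p)| v_n)² ≤ Σ_n g(ω_n(p)) v_n²` — i.e. `|t⟩⟨t| ≤ diag g(ω_n)` as forms, «all M at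
once (infinite volume included)». [folklore] -/
theorem flat_block_ineq (p₁ p₂ : ℝ) (v : Alias → ℝ) :
    (∑ n, Real.sqrt (tSq p₁ p₂ n) * v n) ^ 2 ≤ ∑ n, gFlat (omegaA p₁ p₂ n) * v n ^ 2 := by
  refine (rankOne_le_diag_iff (fun n => gFlat_pos _) _).mpr ?_ v
  simp only [sqrt_tSq_sq]
  rw [block_secular_eq]
  exact secularS_le_one_trig p₁ p₂

/-- **BLOCK FORM, HERMITIAN**: for any complex alias amplitudes `t_n` with `‖t_n‖² = |t_n|²(p)` (the plane-wave phases of the tent average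
are immaterial) and every complex `v`: `‖Σ_n conj(t_n) v_n‖² ≤ Σ_n g(ω_n(p)) ‖v_n‖²`. [folklore] -/
theorem flat_block_ineq_complex (p₁ p₂ : ℝ) {t : Alias → ℂ} (ht : ∀ n, ‖t n‖ ^ 2 = tSq p₁ p₂ n) (v : Alias → ℂ) :
    ‖∑ n, starRingEnd ℂ (t n) * v n‖ ^ 2 ≤ ∑ n, gFlat (omegaA p₁ p₂ n) * ‖v n‖ ^ 2 := by
  refine (rankOne_le_diag_iff_complex (fun n => gFlat_pos _) t).mpr ?_ v
  simp only [ht]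
  rw [block_secular_eq]
  exact secularS_le_one_trig p₁ p₂

/-- the quantitative form with the slack visible: `(Σ |t_n| v_n)² ≤ S_φ(p)·Σ g(ω_n) v_n²` and `S_φ(p) ≤ 1`. [folklore] -/
theorem flat_block_ineq_mul (p₁ p₂ : ℝ) (v : Alias → ℝ) :
    (∑ n, Real.sqrt (tSq p₁ p₂ n) * v n) ^ 2
      ≤ secularS (sin (p₁ / 2) ^ 2) (sin (p₂ / 2) ^ 2) * ∑ n, gFlat (omegaA p₁ p₂ n) * v n ^ 2 := by
  have h := rankOne_le_diag_mul (fun n => gFlat_pos (omegaA p₁ p₂ n)) (fun n => Real.sqrt (tSq p₁ p₂ n)) v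
  simp only [sqrt_tSq_sq] at h
  rwa [block_secular_eq] at h

/-- **SHARPNESS ON THE AXES** (lens 1 gen 67: «EF^flat = ⅛(Hess^flat)²(4 − Hess^flat) EXACTLY on every axis alias block»): if `sin p₂ = 0`
or `sin p₁ = 0`, equality in the block inequality is ATTAINED at a non-zero vector (the test vector `v = |t|∕g`). [folklore] -/
theorem flat_block_sharp {p₁ p₂ : ℝ} (hp : sin p₁ = 0 ∨ sin p₂ = 0) :
    ∃ v : Alias → ℝ, v ≠ 0 ∧ (∑ n, Real.sqrt (tSq p₁ p₂ n) * v n) ^ 2 = ∑ n, gFlat (omegaA p₁ p₂ n) * v n ^ 2 := by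
  have hS : secularS (sin (p₁ / 2) ^ 2) (sin (p₂ / 2) ^ 2) = 1 := (secularS_eq_one_trig_iff p₁ p₂).mpr hp
  obtain ⟨e1, e2⟩ := rankOne_test_vector (fun n => gFlat_pos (omegaA p₁ p₂ n)) (fun n => Real.sqrt (tSq p₁ p₂ n))
  simp only [sqrt_tSq_sq] at e1 e2
  rw [block_secular_eq, hS] at e1 e2
  refine ⟨fun n => Real.sqrt (tSq p₁ p₂ n) / gFlat (omegaA p₁ p₂ n), ?_, by rw [e1, e2]; norm_num⟩
  -- the test vector is non-zero because the secular sum at it equals 1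
  intro h0
  have : ∑ n, gFlat (omegaA p₁ p₂ n) * (Real.sqrt (tSq p₁ p₂ n) / gFlat (omegaA p₁ p₂ n)) ^ 2 = 0 :=
    sum_eq_zero fun n _ => by rw [show Real.sqrt (tSq p₁ p₂ n) / gFlat (omegaA p₁ p₂ n) = 0 from congr_fun h0 n]; ring
  rw [e2] at this
  exact one_ne_zero this

/-- **STRICT OFF THE AXES**: if `sin p₁ ≠ 0` and `sin p₂ ≠ 0` then `(Σ |t_n| v_n)² < Σ g(ω_n) v_n²` for every `v ≠ 0` (lens 1: interior
slack `1 − S_φ = A·B·Q̃∕ΠG > 0`, `≍ t⁶` on the diagonal). [folklore] -/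
theorem flat_block_strict {p₁ p₂ : ℝ} (h₁ : sin p₁ ≠ 0) (h₂ : sin p₂ ≠ 0) {v : Alias → ℝ} (hv : v ≠ 0) :
    (∑ n, Real.sqrt (tSq p₁ p₂ n) * v n) ^ 2 < ∑ n, gFlat (omegaA p₁ p₂ n) * v n ^ 2 := by
  have hS : secularS (sin (p₁ / 2) ^ 2) (sin (p₂ / 2) ^ 2) < 1 := by
    refine lt_of_le_of_ne (secularS_le_one_trig p₁ p₂) fun h => ?_
    rcases (secularS_eq_one_trig_iff p₁ p₂).mp h with h | h
    · exact h₁ h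
    · exact h₂ h
  have hW : 0 < ∑ n, gFlat (omegaA p₁ p₂ n) * v n ^ 2 := by
    obtain ⟨n, hn⟩ : ∃ n, v n ≠ (0 : Alias → ℝ) n := Function.ne_iff.mp hv
    have hn' : v n ≠ 0 := by simpa using hn
    have hpos : 0 < gFlat (omegaA p₁ p₂ n) * v n ^ 2 := mul_pos (gFlat_pos _) (by positivity)
    exact lt_of_lt_of_le hpos (single_le_sum (f := fun m => gFlat (omegaA p₁ p₂ m) * v m ^ 2)
      (fun m _ => mul_nonneg (gFlat_pos _).le (sq_nonneg _)) (mem_univ n))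
  calc (∑ n, Real.sqrt (tSq p₁ p₂ n) * v n) ^ 2
      ≤ secularS (sin (p₁ / 2) ^ 2) (sin (p₂ / 2) ^ 2) * ∑ n, gFlat (omegaA p₁ p₂ n) * v n ^ 2 := flat_block_ineq_mul p₁ p₂ v
    _ < 1 * ∑ n, gFlat (omegaA p₁ p₂ n) * v n ^ 2 := by gcongr
    _ = _ := one_mul _

end Summit.QuantumFields.BalabanUV.T4Continuum.NE7EJSecularCriterion

end
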